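import Summits.FinalStateConjecture.FinalStateConjecture.Theorems.EIHFluxBalanceInertialRecessionRechartWhiteHoleKerrMargin
import Summits.FinalStateConjecture.FinalStateConjecture.Theorems.EIHFluxBalanceInertialRecessionRechartWhiteHoleKerrDrift
import Summits.FinalStateConjecture.FinalStateConjecture.Theorems.EIHFluxBalanceInertialRecessionRechartKO
import Summits.FinalStateConjecture.FinalStateConjecture.Theorems.EIHFluxBalanceInertialRecessionRechartOfut
import Literature.Geometry.Lorentzian.ExtensionProofs

/-!
# Route EIHFluxBalance — `InertialRecession`, re-charting: point estimate and causal segment for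
# the escape out of a painted ROTATING white hole

Helper file for the crux `stmt-FinalStateConjecture-10166`
(`Summit.FinalStateConjecture.FinalStateConjecture.Theses.EIHFluxBalance.InertialRecession`),
stub `stub_rechart` of line `sublinear-is-free-clean-window-charges`.

Two self-contained pieces of `exists_escape_curve_spin` (…RechartWhiteHoleKerrEscape):
* `escape_point_estimate` — at a point `x = c₀ + Λ₀(ρe₃) + sΛ₀w₀` of the lab escape segment with
  lab time `T`, given the frozen frame `Λ₀`, a normalised frame `Qt` at `T` painting like the raw
  frame `ΛT`, the inverse-frame drift `‖Qt − Λ₀‖ ≤ δ/(Γ² + 1)`, the centre drift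
  `‖ξ_T − ξ₀ − (T − t₀)v(Λ₀)‖ ≤ δ` and the uniform margin of `exists_kerr_escape_margin`: the painted
  radius of hole `i` is within `ε` of `ρ + s/2`, its painted value on `W₀ = Λ₀w₀` is below the exact
  axis value plus `ε`, and the lab distance to the centre is bounded;
* `isFutureCausalCurveOn_segment` — a lab segment `σ ↦ x_c + (c₁ arctan σ)W₀` with model value
  `≤ −m`, `C⁰` deviation `≤ c`, `c‖W₀‖² < m`, `W₀⁰ > 0` and (Ofut) at its points pushes forward to a
  future causal curve.
Plus small facts (`lorentz_inversePair`, `norm_sub_abs_le_radius_poincareInv`, …; `|v⁰| ≤ ‖v‖` is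
`C0Extension.abs_apply_zero_le_norm`).
[folklore; Kerr–Schild 1965; O'Neill 1983, Ch. 14]
-/

noncomputable section

set_option linter.dupNamespace false

open scoped InnerProductSpace Topology Manifold ContDiff BigOperators
open Set Function Filter Metric TopologicalSpace Literature.Geometry.Lorentzian

namespace Summit.FinalStateConjecture.FinalStateConjecture.Theorems

/-! ### Small facts -/

/-- The size parameter `θ = min(r₊/40, (r₊ − rin)/6)` of the escape segment is positive.
[folklore] -/
theorem escape_theta_pos_spin {rp r : ℝ} (hrp : 0 < rp) (hr : r < rp) :
    0 < min (rp / 40) ((rp - r) / 6) :=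
  lt_min (by positivity) (by linarith)

/-- `M ≤ r₊(M, a)`. [folklore] -/
theorem le_rPlus_self (M a : ℝ) : M ≤ Kerr.rPlus M a := by
  unfold Kerr.rPlus; linarith [Real.sqrt_nonneg (M ^ 2 - a ^ 2)]

/-- **Lab distance minus `|a|` is at most the painted radius** on the lab slab through the centre.
[folklore] -/
theorem norm_sub_abs_le_radius_poincareInv (Λ : lorentzGroup) (a t : ℝ) (ξ : E3) {x : E4}
    (hx : x 0 = t) :
    ‖E4.spatial x - ξ‖ - |a| ≤ Kerr.radius a (poincareInv Λ (E4.ofTimeSpace t ξ) x) := by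
  have h := sq_sub_sq_le_radius_poincareInv_sq Λ a t ξ hx
  have hr := Kerr.radius_nonneg a (poincareInv Λ (E4.ofTimeSpace t ξ) x)
  set d := ‖E4.spatial x - ξ‖ with hd
  have hd0 : 0 ≤ d := norm_nonneg _
  by_cases hle : d ≤ |a|
  · linarith
  · push Not at hle
    have h1 : (d - |a|) ^ 2 ≤ Kerr.radius a (poincareInv Λ (E4.ofTimeSpace t ξ) x) ^ 2 := by
      have : (d - |a|) ^ 2 ≤ d ^ 2 - a ^ 2 := by rw [← sq_abs a]; nlinarith [abs_nonneg a]
      linarith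
    exact (sq_le_sq₀ (by linarith) hr).mp h1

/-- The operator of a Lorentz map and its inverse form an inverse pair of norms `≤ 1 + 3γ`.
[folklore] -/
theorem lorentz_inversePair (Λ : lorentzGroup) {γ : ℝ}
    (hγ : |((Λ : E4 ≃L[ℝ] E4) (E4.basisVector 0)) 0| ≤ γ) :
    (((Λ : E4 ≃L[ℝ] E4).symm : E4 ≃L[ℝ] E4) : E4 →L[ℝ] E4).comp ((Λ : E4 ≃L[ℝ] E4) : E4 →L[ℝ] E4) = 1 ∧
      ((Λ : E4 ≃L[ℝ] E4) : E4 →L[ℝ] E4).comp (((Λ : E4 ≃L[ℝ] E4).symm : E4 ≃L[ℝ] E4) : E4 →L[ℝ] E4) = 1 ∧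
      ‖(((Λ : E4 ≃L[ℝ] E4).symm : E4 ≃L[ℝ] E4) : E4 →L[ℝ] E4)‖ ≤ 1 + 3 * γ ∧
      ‖((Λ : E4 ≃L[ℝ] E4) : E4 →L[ℝ] E4)‖ ≤ 1 + 3 * γ :=
  ⟨ContinuousLinearEquiv.coe_symm_comp_coe _, ContinuousLinearEquiv.coe_comp_coe_symm _,
    (norm_lorentz_symm_le' Λ).trans (by linarith), (norm_lorentz_le Λ).trans (by linarith)⟩

/-! ### The point estimate -/

-- bookkeeping
set_option maxHeartbeats 1600000 in
/-- **Painted radius, painted own value and lab offset at a point of the escape segment.** See the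
module docstring. [folklore] -/
theorem escape_point_estimate (M a Γ ρ θ Lw ε δ : ℝ) (hΓ : 0 ≤ Γ) (hρ : 0 ≤ ρ)
    (hmarg : ∀ (P Qm : E4 →L[ℝ] E4), P.comp Qm = 1 → Qm.comp P = 1 → ‖P‖ ≤ Γ → ‖Qm‖ ≤ Γ →
      ∀ s ∈ Icc (-(8 * θ)) (8 * θ), ∀ τ ∈ Icc (-Lw) Lw, ∀ (P' : E4 →L[ℝ] E4) (z' : E4), ‖P' - P‖ ≤ δ →
        ‖z' - Qm ((-s - τ) • E4.basisVector 0 + (ρ + s / 2) • E4.basisVector 3)‖ ≤ δ →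
        |Kerr.radius a (P' z') - (ρ + s / 2)| < ε ∧
          Kerr.bilin M a (P' z') (P' (Qm (-E4.basisVector 0 + (1 / 2 : ℝ) • E4.basisVector 3)))
              (P' (Qm (-E4.basisVector 0 + (1 / 2 : ℝ) • E4.basisVector 3))) <
            -(3 / 4) + M * (ρ + s / 2) / (2 * ((ρ + s / 2) ^ 2 + a ^ 2)) + ε)
    (Λ₀ Qt ΛT : lorentzGroup)
    (hpair₀ : (((Λ₀ : E4 ≃L[ℝ] E4).symm : E4 ≃L[ℝ] E4) : E4 →L[ℝ] E4).comp ((Λ₀ : E4 ≃L[ℝ] E4) : E4 →L[ℝ] E4) = 1 ∧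
      ((Λ₀ : E4 ≃L[ℝ] E4) : E4 →L[ℝ] E4).comp (((Λ₀ : E4 ≃L[ℝ] E4).symm : E4 ≃L[ℝ] E4) : E4 →L[ℝ] E4) = 1 ∧
      ‖(((Λ₀ : E4 ≃L[ℝ] E4).symm : E4 ≃L[ℝ] E4) : E4 →L[ℝ] E4)‖ ≤ Γ ∧ ‖((Λ₀ : E4 ≃L[ℝ] E4) : E4 →L[ℝ] E4)‖ ≤ Γ)
    (hpairT : ‖(((Qt : E4 ≃L[ℝ] E4).symm : E4 ≃L[ℝ] E4) : E4 →L[ℝ] E4)‖ ≤ Γ)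
    (hQbil : ∀ c x, boostedKerrBilin ΛT c M a x = boostedKerrBilin Qt c M a x)
    (hQrad : ∀ c x, Kerr.radius a (poincareInv ΛT c x) = Kerr.radius a (poincareInv Qt c x))
    {t₀ T s : ℝ} (ξ₀ ξT : E3) {x : E4}
    (hx : x = E4.ofTimeSpace t₀ ξ₀ + (Λ₀ : E4 ≃L[ℝ] E4) (ρ • E4.basisVector 3) +
      s • (Λ₀ : E4 ≃L[ℝ] E4) (-E4.basisVector 0 + (1 / 2 : ℝ) • E4.basisVector 3))
    (hT : x 0 = T) (hs : s ∈ Icc (-(8 * θ)) (8 * θ)) (hTwin : |T - t₀| ≤ Lw)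
    (hdriftQ : ‖((Qt : E4 ≃L[ℝ] E4) : E4 →L[ℝ] E4) - ((Λ₀ : E4 ≃L[ℝ] E4) : E4 →L[ℝ] E4)‖ ≤ δ / (Γ ^ 2 + 1))
    (hdriftξ : ‖ξT - ξ₀ - (T - t₀) • (((((Λ₀ : E4 ≃L[ℝ] E4) (E4.basisVector 0)) 0)⁻¹ •
      E4.spatial ((Λ₀ : E4 ≃L[ℝ] E4) (E4.basisVector 0))))‖ ≤ δ) :
    |Kerr.radius a (poincareInv ΛT (E4.ofTimeSpace T ξT) x) - (ρ + s / 2)| < ε ∧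
      boostedKerrBilin ΛT (E4.ofTimeSpace T ξT) M a x
          ((Λ₀ : E4 ≃L[ℝ] E4) (-E4.basisVector 0 + (1 / 2 : ℝ) • E4.basisVector 3))
          ((Λ₀ : E4 ≃L[ℝ] E4) (-E4.basisVector 0 + (1 / 2 : ℝ) • E4.basisVector 3)) <
        -(3 / 4) + M * (ρ + s / 2) / (2 * ((ρ + s / 2) ^ 2 + a ^ 2)) + ε ∧
      ‖E4.spatial x - ξT‖ ≤ Γ * (8 * θ + Lw + (ρ + 4 * θ)) + δ := by
  set w₀ : E4 := -E4.basisVector 0 + (1 / 2 : ℝ) • E4.basisVector 3 with hw₀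
  set u₀ : E4 := (Λ₀ : E4 ≃L[ℝ] E4) (E4.basisVector 0) with hu₀
  set τ : ℝ := (T - t₀) / u₀ 0 with hτ
  have hu₀1 : 1 ≤ |u₀ 0| := one_le_abs_lorentz_apply_zero Λ₀
  have hτI : τ ∈ Icc (-Lw) Lw := by
    have h1 : |τ| ≤ Lw := by
      rw [hτ, abs_div]
      calc |T - t₀| / |u₀ 0| ≤ |T - t₀| / 1 := div_le_div_of_nonneg_left (abs_nonneg _) one_pos hu₀1
        _ ≤ Lw := by rw [div_one]; exact hTwin
    exact ⟨(abs_le.mp h1).1, (abs_le.mp h1).2⟩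
  -- the offset and the inverse frames
  set z : E4 := x - E4.ofTimeSpace T ξT with hz
  set P' : E4 →L[ℝ] E4 := (((Qt : E4 ≃L[ℝ] E4).symm : E4 ≃L[ℝ] E4) : E4 →L[ℝ] E4) with hP'
  set P : E4 →L[ℝ] E4 := (((Λ₀ : E4 ≃L[ℝ] E4).symm : E4 ≃L[ℝ] E4) : E4 →L[ℝ] E4) with hP
  set Qf : E4 →L[ℝ] E4 := ((Λ₀ : E4 ≃L[ℝ] E4) : E4 →L[ℝ] E4) with hQf
  -- drift of the inverse frame
  have hPd : ‖P' - P‖ ≤ δ := by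
    have hδ0 : 0 ≤ δ := by
      have h := hdriftQ.trans' (norm_nonneg _)
      have : 0 < Γ ^ 2 + 1 := by positivity
      exact (div_nonneg_iff.mp h).elim (fun h ↦ h.1) fun h ↦ absurd h.2 (not_le.mpr this)
    calc ‖P' - P‖ ≤ ‖P'‖ * ‖((Qt : E4 ≃L[ℝ] E4) : E4 →L[ℝ] E4) - ((Λ₀ : E4 ≃L[ℝ] E4) : E4 →L[ℝ] E4)‖ *
          ‖P‖ := norm_symm_sub_symm_le (Qt : E4 ≃L[ℝ] E4) (Λ₀ : E4 ≃L[ℝ] E4)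
      _ ≤ Γ * (δ / (Γ ^ 2 + 1)) * Γ :=
          mul_le_mul (mul_le_mul hpairT hdriftQ (norm_nonneg _) hΓ) hpair₀.2.2.1 (norm_nonneg _)
            (by positivity)
      _ ≤ δ := by
          rw [show Γ * (δ / (Γ ^ 2 + 1)) * Γ = δ * (Γ ^ 2 / (Γ ^ 2 + 1)) by ring]
          have : Γ ^ 2 / (Γ ^ 2 + 1) ≤ 1 := by rw [div_le_one (by positivity)]; linarith
          nlinarith
  -- the exact offset and the centre drift
  have hzex : x - E4.ofTimeSpace T (ξ₀ + (T - t₀) • ((u₀ 0)⁻¹ • E4.spatial u₀)) =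
      Qf ((-s - τ) • E4.basisVector 0 + (ρ + s / 2) • E4.basisVector 3) := by
    have h := offset_model_eq Λ₀ t₀ ξ₀ (ρ • E4.basisVector 3) w₀ s (x := x) (T := T) hx hT
    rw [h, ← escapeConfig_eq ρ s τ]
    rfl
  have hzd : ‖z - Qf ((-s - τ) • E4.basisVector 0 + (ρ + s / 2) • E4.basisVector 3)‖ ≤ δ := by
    rw [← hzex, hz, show ∀ (p q r : E4), p - q - (p - r) = r - q from fun p q r ↦ by abel,
      ← one_smul ℝ (E4.ofTimeSpace T ξT), ofTimeSpace_sub_smul, one_mul, sub_self, one_smul,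
      norm_eq_spatialNorm_of_apply_zero_eq_zero (E4.ofTimeSpace_apply_zero 0 _),
      E4.spatialNorm_ofTimeSpace, show ξ₀ + (T - t₀) • ((u₀ 0)⁻¹ • E4.spatial u₀) - ξT =
        -(ξT - ξ₀ - (T - t₀) • ((u₀ 0)⁻¹ • E4.spatial u₀)) by abel, norm_neg]
    exact hdriftξ
  -- the margin
  obtain ⟨hR, hV⟩ := hmarg P Qf hpair₀.1 hpair₀.2.1 hpair₀.2.2.1 hpair₀.2.2.2 s hs τ hτI P' z hPd hzd
  -- the painted radius and value through the normalised frame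
  have hrad : Kerr.radius a (poincareInv ΛT (E4.ofTimeSpace T ξT) x) = Kerr.radius a (P' z) := by
    rw [hQrad, radius_poincareInv_eq_symm_clm]
  have hval : boostedKerrBilin ΛT (E4.ofTimeSpace T ξT) M a x ((Λ₀ : E4 ≃L[ℝ] E4) w₀)
      ((Λ₀ : E4 ≃L[ℝ] E4) w₀) = Kerr.bilin M a (P' z) (P' (Qf w₀)) (P' (Qf w₀)) := by
    rw [hQbil, boostedKerrBilin_eq_symm_clm]
    rfl
  -- the lab distance to the centre
  have hdist : ‖E4.spatial x - ξT‖ ≤ Γ * (8 * θ + Lw + (ρ + 4 * θ)) + δ := by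
    obtain ⟨-, hn'⟩ := sub_ofTimeSpace_apply_zero hT ξT
    rw [← hn']
    have h1 : ‖z‖ ≤ ‖Qf ((-s - τ) • E4.basisVector 0 + (ρ + s / 2) • E4.basisVector 3)‖ + δ :=
      (norm_le_norm_add_norm_sub' z _).trans (by linarith)
    have h2 : ‖Qf ((-s - τ) • E4.basisVector 0 + (ρ + s / 2) • E4.basisVector 3)‖ ≤
        Γ * (8 * θ + Lw + (ρ + 4 * θ)) := by
      refine (Qf.le_opNorm _).trans ?_
      have h3 := norm_escapeConfig_le ρ s τ
      have h4 : |s| + |τ| + |ρ + s / 2| ≤ 8 * θ + Lw + (ρ + 4 * θ) := by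
        have : |s| ≤ 8 * θ := abs_le.mpr hs
        have : |τ| ≤ Lw := abs_le.mpr hτI
        have : |ρ + s / 2| ≤ ρ + 4 * θ := by
          rw [abs_le]; constructor <;> linarith [hs.1, hs.2]
        linarith
      exact mul_le_mul hpair₀.2.2.2 (h3.trans h4) (norm_nonneg _) hΓ
    show ‖z‖ ≤ Γ * (8 * θ + Lw + (ρ + 4 * θ)) + δ
    linarith
  exact ⟨by rwa [hrad], by rwa [hval], hdist⟩

/-! ### The causal segment -/

/-- **A certified lab segment pushes forward to a future causal curve.** See the module docstring.
[folklore] -/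
theorem isFutureCausalCurveOn_segment {𝓢 : Spacetime 4} (Kb : ModelBackground)
    (Φ : Kb.domain → 𝓢.carrier) (hΦ : ContMDiff 𝓘(ℝ, E4) (𝓡 4) ∞ Φ) (Qp : Kb.domain → Prop)
    (hOfut : ∀ x : Kb.domain, Qp x → ∀ w : E4, 0 < w 0 →
      𝓢.metric.val (Φ x) (mfderiv 𝓘(ℝ, E4) (𝓡 4) Φ x w) (mfderiv 𝓘(ℝ, E4) (𝓡 4) Φ x w) < 0 →
        𝓢.timeOrientation.IsFutureDirected (mfderiv 𝓘(ℝ, E4) (𝓡 4) Φ x w))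
    (xc W₀ : E4) {c₁ m c : ℝ} (hc₁ : 0 < c₁) (hW : 0 < W₀ 0)
    (hU : ∀ σ : ℝ, xc + (c₁ * Real.arctan σ) • W₀ ∈ (Kb.domain : Set E4))
    (hQ : ∀ σ, Qp ⟨xc + (c₁ * Real.arctan σ) • W₀, hU σ⟩)
    (hbil : ∀ σ, Kb.bilin (xc + (c₁ * Real.arctan σ) • W₀) W₀ W₀ ≤ -m) (hcm : c * ‖W₀‖ ^ 2 < m)
    (hdev : ∀ σ, ‖𝓢.deviation Kb Φ ⟨xc + (c₁ * Real.arctan σ) • W₀, hU σ⟩‖ ≤ c) :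
    𝓢.metric.IsFutureCausalCurveOn 𝓢.timeOrientation
      (fun σ ↦ Φ ⟨xc + (c₁ * Real.arctan σ) • W₀, hU σ⟩) (Icc 0 1) := by
  set xs : ℝ → E4 := fun σ ↦ xc + (c₁ * Real.arctan σ) • W₀ with hxs
  have hfd : ∀ σ, 𝓢.timeOrientation.IsFutureDirected (mfderiv 𝓘(ℝ, E4) (𝓡 4) Φ ⟨xs σ, hU σ⟩ W₀) :=
    fun σ ↦ isFutureDirected_mfderiv_comp_of_deviation Kb Kb.domain Φ hΦ (A := id) contDiff_id
      (fun x hx ↦ hx) Qp hOfut ⟨xs σ, hU σ⟩ W₀ (hQ σ) (by rw [fderiv_id]; exact hW) (hbil σ) hcm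
      (hdev σ)
  have hp : ContDiff ℝ ∞ xs := by
    rw [hxs]
    exact contDiff_const.add ((contDiff_const.mul Real.contDiff_arctan).smul contDiff_const)
  have hpd : ∀ σ, HasDerivAt xs ((c₁ / (1 + σ ^ 2)) • W₀) σ := by
    intro σ
    have h1 : HasDerivAt (fun s ↦ c₁ * Real.arctan s) (c₁ * (1 / (1 + σ ^ 2))) σ :=
      (Real.hasDerivAt_arctan σ).const_mul c₁
    have h2 := (h1.smul_const W₀).const_add xc
    refine h2.congr_deriv ?_
    rw [mul_one_div]
  intro σ _
  obtain ⟨hd, hv⟩ := velocity_comp_smooth_curve hΦ hp hU (hpd σ)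
  refine ⟨hd, ?_⟩
  have hv' : velocity (𝓡 4) (fun s ↦ Φ ⟨xs s, hU s⟩) σ =
      (c₁ / (1 + σ ^ 2)) • mfderiv 𝓘(ℝ, E4) (𝓡 4) Φ ⟨xs σ, hU σ⟩ W₀ := by
    rw [hv]
    exact (mfderiv 𝓘(ℝ, E4) (𝓡 4) Φ ⟨xs σ, hU σ⟩).map_smul _ _
  show 𝓢.timeOrientation.IsFutureDirected (velocity (𝓡 4) (fun s ↦ Φ ⟨xs s, hU s⟩) σ)
  rw [hv']
  exact (hfd σ).smul (by positivity)

/-- Registered one-line form (stub `escape_theta_pos_spin_rechart` of the crux item) of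
`escape_theta_pos_spin`. [folklore] -/
theorem escape_theta_pos_spin_rechart : ∀ {rp r : ℝ}, 0 < rp → r < rp → 0 < min (rp / 40) ((rp - r) / 6) :=
  fun hrp hr ↦ escape_theta_pos_spin hrp hr

end Summit.FinalStateConjecture.FinalStateConjecture.Theorems
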